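import Literature.Geometry.Lorentzian.InitialData
import Literature.Geometry.Lorentzian.MetricNormSq
import HarnessLib

/-!
# Maximal initial data have nonnegative scalar curvature

For an initial data set `D = (h, k)` on a manifold `X` the Hamiltonian constraint function is
`R(h) - |k|²_h + (tr_h k)²` (`InitialDataSet.hamiltonianConstraintFn`). Where it vanishes (the
vacuum, or `μ = 0`, Hamiltonian constraint) the scalar curvature of the slice is
`R(h) = |k|²_h - (tr_h k)²`, so on a **maximal** slice (`tr_h k = 0`) one has
`R(h) = |k|²_h ≥ 0`: "a CMC asymptotically Euclidean initial data set necessarily has `τ = 0`,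
so that (2) becomes `R = |Π|² ≥ 0`" (Isenberg–Mazzeo–Pollack, Ann. Henri Poincaré 4 (2003) 369,
Introduction, p. 371, after Thm. 1; arXiv:gr-qc/0206034). This pointwise sign is the first step of
every topological / positive-mass argument on maximal slices: the no-maximal-slice theorem for
non-PSC topologies (ibid., Thm. 4), and Schoen–Yau's reduction of the positive mass theorem for
maximal data to the case `R ≥ 0` (Comm. Math. Phys. 65 (1979) 45, §1).

## Contents (namespace `Literature.Geometry.Lorentzian.InitialDataSet`)

* `normSqK_nonneg` — `0 ≤ |k|²_h` (the data metric is Riemannian; `PseudoRiemannianMetric.normSq_nonneg`).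
* `scalarCurvature_eq_of_hamiltonianConstraintFn_eq_zero` — `R(h) = |k|²_h - (tr_h k)²` where the
  Hamiltonian constraint function vanishes.
* `scalarCurvature_eq_normSqK_of_isMaximalData`, `scalarCurvature_nonneg_of_isMaximalData` —
  `R(h) = |k|²_h ≥ 0` for maximal data satisfying the Hamiltonian constraint; the vacuum corollary
  `IsVacuumConstraintSolution.scalarCurvature_nonneg_of_isMaximalData`.

All statements are for an arbitrary model `I` with finite-dimensional model space, under the
standing Levi-Civita instance `[D.metric.HasLeviCivita]` of `InitialData`.

## References

* J. Isenberg, R. Mazzeo, D. Pollack, *On the topology of vacuum spacetimes*, Ann. Henri Poincaré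
  4 (2003) 369–383, arXiv:gr-qc/0206034, Introduction p. 371 and Thm. 4.
* R. Schoen, S.-T. Yau, *On the proof of the positive mass conjecture in general relativity*,
  Comm. Math. Phys. 65 (1979) 45–76, §1.
* R. Bartnik, J. Isenberg, *The constraint equations* (2004), §2, (2.1).
-/

noncomputable section

open Manifold Bundle
open scoped ContDiff

namespace Literature.Geometry.Lorentzian

namespace InitialDataSet

variable {E : Type*} [NormedAddCommGroup E] [NormedSpace ℝ E] {H : Type*} [TopologicalSpace H]
  {I : ModelWithCorners ℝ E H} {X : Type*} [TopologicalSpace X] [ChartedSpace H X]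
  [IsManifold I ∞ X] [FiniteDimensional ℝ E]

/-- **`|k|²_h ≥ 0`**: the square norm of the second fundamental form of an initial data set is
nonnegative, the data metric `h` being Riemannian (`PseudoRiemannianMetric.normSq_nonneg`).
Bartnik–Isenberg 2004, §2, (2.1); Isenberg–Mazzeo–Pollack 2003, p. 371 (`R = |Π|² ≥ 0`).
[cite: IsenbergMazzeoPollack2002, Introduction p. 371] -/
theorem normSqK_nonneg (D : InitialDataSet I X) (x : X) : 0 ≤ D.normSqK x :=
  D.metric.normSq_nonneg x D.isRiemannian_metric _

/-- Where the Hamiltonian constraint function `R(h) - |k|²_h + (tr_h k)²` vanishes, the scalar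
curvature of the slice is `R(h) = |k|²_h - (tr_h k)²`. Bartnik–Isenberg 2004, (2.1) with `μ = 0`;
Isenberg–Mazzeo–Pollack 2003, (2). [cite: IsenbergMazzeoPollack2002, Introduction (2)] -/
theorem scalarCurvature_eq_of_hamiltonianConstraintFn_eq_zero (D : InitialDataSet I X)
    [D.metric.HasLeviCivita] {x : X} (hH : D.hamiltonianConstraintFn x = 0) :
    D.metric.scalarCurvature x = D.normSqK x - D.traceK x ^ 2 := by
  have h : D.metric.scalarCurvature x - D.normSqK x + D.traceK x ^ 2 = 0 := hH
  linarith

/-- **Maximal data satisfying the Hamiltonian constraint have `R(h) = |k|²_h`**: with `tr_h k = 0`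
the constraint `R(h) - |k|²_h + (tr_h k)² = 0` reads `R(h) = |k|²_h`. Isenberg–Mazzeo–Pollack,
Ann. Henri Poincaré 4 (2003) 369, p. 371 ("`τ = 0`, so that (2) becomes `R = |Π|² ≥ 0`").
[cite: IsenbergMazzeoPollack2002, Introduction p. 371] -/
theorem scalarCurvature_eq_normSqK_of_isMaximalData (D : InitialDataSet I X)
    [D.metric.HasLeviCivita] (hH : ∀ x, D.hamiltonianConstraintFn x = 0)
    (hmax : D.IsMaximalData) (x : X) : D.metric.scalarCurvature x = D.normSqK x := by
  rw [D.scalarCurvature_eq_of_hamiltonianConstraintFn_eq_zero (hH x), hmax x]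
  ring

/-- **Maximal data satisfying the Hamiltonian constraint have nonnegative scalar curvature**,
`R(h) = |k|²_h ≥ 0` — the pointwise sign behind the no-maximal-slice theorem on non-PSC
topologies and behind the reduction of the positive mass theorem for maximal data to `R ≥ 0`.
Isenberg–Mazzeo–Pollack, Ann. Henri Poincaré 4 (2003) 369, p. 371 and Thm. 4; Schoen–Yau,
Comm. Math. Phys. 65 (1979) 45, §1. [cite: IsenbergMazzeoPollack2002, Introduction p. 371] -/
theorem scalarCurvature_nonneg_of_isMaximalData (D : InitialDataSet I X) [D.metric.HasLeviCivita]
    (hH : ∀ x, D.hamiltonianConstraintFn x = 0) (hmax : D.IsMaximalData) (x : X) :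
    0 ≤ D.metric.scalarCurvature x := by
  rw [D.scalarCurvature_eq_normSqK_of_isMaximalData hH hmax x]
  exact D.normSqK_nonneg x

/-- **A maximal solution of the vacuum constraint equations has `R(h) = |k|²_h ≥ 0`.**
Isenberg–Mazzeo–Pollack, Ann. Henri Poincaré 4 (2003) 369, p. 371 ("a CMC asymptotically
Euclidean initial data set necessarily has `τ = 0`, so that (2) becomes `R = |Π|² ≥ 0`").
[cite: IsenbergMazzeoPollack2002, Introduction p. 371] -/
theorem IsVacuumConstraintSolution.scalarCurvature_nonneg_of_isMaximalData {D : InitialDataSet I X}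
    [D.metric.HasLeviCivita] (hvac : D.IsVacuumConstraintSolution) (hmax : D.IsMaximalData)
    (x : X) : 0 ≤ D.metric.scalarCurvature x :=
  D.scalarCurvature_nonneg_of_isMaximalData (fun y ↦ (hvac y).1) hmax x

/-- For a maximal solution of the vacuum constraints, `R(h) = |k|²_h` pointwise.
Isenberg–Mazzeo–Pollack 2003, p. 371. [cite: IsenbergMazzeoPollack2002, Introduction p. 371] -/
theorem IsVacuumConstraintSolution.scalarCurvature_eq_normSqK_of_isMaximalData
    {D : InitialDataSet I X} [D.metric.HasLeviCivita] (hvac : D.IsVacuumConstraintSolution)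
    (hmax : D.IsMaximalData) (x : X) : D.metric.scalarCurvature x = D.normSqK x :=
  D.scalarCurvature_eq_normSqK_of_isMaximalData (fun y ↦ (hvac y).1) hmax x

end InitialDataSet

end Literature.Geometry.Lorentzian

end
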